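import Mathlib.Topology.Algebra.OpenSubgroup
import Mathlib.Topology.Algebra.ClopenNhdofOne
import Mathlib.GroupTheory.GroupAction.Basic
import Mathlib.Tactic.Group
import HarnessLib

/-!
# Orbit closure for profinite group actions with closed stabilisers

Topic `GroupTheory` (profinite groups); namespace `Literature.GroupTheory.LocallyConstantCocycles`.
Proof file: theorems only (no definition, no instance, no named fact).

For a profinite group `Γ` acting on a set `P` with CLOSED stabilisers (e.g. `Γ = Gal(K̄/K)` acting on
the primes of `K̄`, whose stabilisers are the decomposition groups), a closed subgroup `H ≤ Γ` and
`p, q ∈ P`: if `q ∈ V • p` for every open subgroup `V ⊇ H`, then `q ∈ H • p`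
(`exists_mem_smul_eq_of_forall_open`; Cantor's intersection theorem for the closed transporters
`{g ∈ H N | g • p = q}`, `N` open normal), together with the elementary fact that a closed subgroup
is the intersection of the open subgroups `H N` containing it
(`mem_of_forall_mem_sup_openNormalSubgroup`).  Used in Neukirch's characterisation of decomposition
groups ([NeukirchSchmidtWingberg2008] XII §1) to pass from "conjugate at every finite level" to
"conjugate under `H`".

## References

* J. Neukirch, A. Schmidt, K. Wingberg, *Cohomology of Number Fields* (2nd ed. 2008), XII §1.
  [NeukirchSchmidtWingberg2008]
* L. Ribes, P. Zalesskii, *Profinite Groups* (2nd ed. 2010), §2.1. [RibesZalesskii2010]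
-/

open Topology
open scoped Pointwise

universe u w

namespace Literature.GroupTheory.LocallyConstantCocycles

variable {Γ : Type u} [Group Γ] [TopologicalSpace Γ]

omit [TopologicalSpace Γ] in
/-- Elements of `H ⊔ N`, `N` normal, factor as `h * n` (restated locally to keep this file
import-light). [folklore] -/
private theorem exists_mul_eq_of_mem_sup' {H N : Subgroup Γ} [N.Normal] {g : Γ} (hg : g ∈ H ⊔ N) :
    ∃ h ∈ H, ∃ n ∈ N, g = h * n := by
  have : g ∈ ((H ⊔ N : Subgroup Γ) : Set Γ) := hg
  rw [Subgroup.mul_normal] at this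
  obtain ⟨h, hh, n, hn, rfl⟩ := Set.mem_mul.mp this
  exact ⟨h, hh, n, hn, rfl⟩

/-! ### Orbit closure for actions with closed stabilisers -/

section Orbit

variable [IsTopologicalGroup Γ] [CompactSpace Γ] [TotallyDisconnectedSpace Γ]

/-- A closed subgroup of a profinite group is the intersection of the open subgroups `H N`
(`N` open normal) containing it: if `g ∈ H N` for every open normal `N`, then `g ∈ H`
(Ribes–Zalesskii, *Profinite Groups*, Prop. 2.1.4 (a)). [cite: RibesZalesskii2010, Prop. 2.1.4] -/
theorem mem_of_forall_mem_sup_openNormalSubgroup {H : Subgroup Γ} (hH : IsClosed (H : Set Γ))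
    {g : Γ} (hg : ∀ N : OpenNormalSubgroup Γ, g ∈ H ⊔ (N : Subgroup Γ)) : g ∈ H := by
  have : g ∈ closure (H : Set Γ) := by
    rw [mem_closure_iff]
    intro W hW hgW
    have h1 : (1 : Γ) ∈ (fun n => g * n) ⁻¹' W := by simpa using hgW
    obtain ⟨N, hN⟩ := ProfiniteGrp.exist_openNormalSubgroup_sub_open_nhds_of_one
      (hW.preimage (continuous_const.mul continuous_id)) h1
    obtain ⟨h, hh, n, hn, he⟩ := exists_mul_eq_of_mem_sup' (hg N)
    refine ⟨h, ?_, hh⟩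
    have : h = g * n⁻¹ := by rw [he]; group
    rw [this]
    exact hN (N.toSubgroup.inv_mem hn)
  rwa [hH.closure_eq] at this

/-- **Orbit closure**: let a profinite group `Γ` act on a set `P` with CLOSED stabilisers, `H ≤ Γ` a
closed subgroup and `p, q ∈ P`.  If `q ∈ V • p` for every open subgroup `V ⊇ H`, then `q ∈ H • p`.
(Cantor's intersection theorem for the closed sets `{g ∈ H N | g • p = q}`; the compactness step
of [NSW] XII §1 in the passage from finite levels to `K̄`). [cite: NeukirchSchmidtWingberg2008, XII §1] -/
theorem exists_mem_smul_eq_of_forall_open {P : Type w} [MulAction Γ P]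
    (hst : ∀ p : P, IsClosed (MulAction.stabilizer Γ p : Set Γ)) {H : Subgroup Γ}
    (hH : IsClosed (H : Set Γ)) {p q : P}
    (h : ∀ V : Subgroup Γ, IsOpen (V : Set Γ) → H ≤ V → ∃ v ∈ V, v • p = q) :
    ∃ g ∈ H, g • p = q := by
  -- the transporter `{g | g • p = q}` is closed
  obtain ⟨g₀, -, hg₀⟩ := h ⊤ isOpen_univ le_top
  have hT : IsClosed {g : Γ | g • p = q} := by
    have : {g : Γ | g • p = q} = (fun g => g₀⁻¹ * g) ⁻¹' (MulAction.stabilizer Γ p : Set Γ) := by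
      ext g
      simp only [Set.mem_setOf_eq, Set.mem_preimage, SetLike.mem_coe, MulAction.mem_stabilizer_iff,
        mul_smul]
      constructor
      · intro hg; rw [hg, ← hg₀, inv_smul_smul]
      · intro hg
        have := congrArg (g₀ • ·) hg
        simpa [smul_smul, hg₀] using this
    rw [this]
    exact (hst p).preimage (continuous_const.mul continuous_id)
  let Ntop : OpenNormalSubgroup Γ := ⟨⊤, by change (⊤ : Subgroup Γ).Normal; infer_instance⟩
  haveI : Nonempty (OpenNormalSubgroup Γ) := ⟨Ntop⟩
  let C : OpenNormalSubgroup Γ → Set Γ := fun N => ((H ⊔ (N : Subgroup Γ) : Subgroup Γ) : Set Γ) ∩ {g | g • p = q}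
  have hCanti : ∀ N N' : OpenNormalSubgroup Γ, N ≤ N' → C N ⊆ C N' := by
    intro N N' hNN' g hg
    exact ⟨(sup_le_sup_left (show (N : Subgroup Γ) ≤ (N' : Subgroup Γ) from hNN') H) hg.1, hg.2⟩
  have hCne : ∀ N, (C N).Nonempty := by
    intro N
    obtain ⟨v, hv, hvp⟩ := h (H ⊔ (N : Subgroup Γ)) (Subgroup.isOpen_mono le_sup_right N.isOpen) le_sup_left
    exact ⟨v, hv, hvp⟩
  have hCcl : ∀ N, IsClosed (C N) := fun N =>
    ((H ⊔ (N : Subgroup Γ)).isClosed_of_isOpen (Subgroup.isOpen_mono le_sup_right N.isOpen)).inter hT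
  have hdir : Directed (· ⊇ ·) C := by
    intro N N'
    exact ⟨N ⊓ N', hCanti _ _ inf_le_left, hCanti _ _ inf_le_right⟩
  obtain ⟨g, hg⟩ := IsCompact.nonempty_iInter_of_directed_nonempty_isCompact_isClosed C hdir hCne
    (fun N => (hCcl N).isCompact) hCcl
  rw [Set.mem_iInter] at hg
  exact ⟨g, mem_of_forall_mem_sup_openNormalSubgroup hH fun N => (hg N).1, (hg Ntop).2⟩

end Orbit

end Literature.GroupTheory.LocallyConstantCocycles
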